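import Mathlib
import HarnessLib
/-!
# Route `KLProgramme` (K1 `H10TwoPointLimit`, K3 `KLRegimeTwoPointLimit`) — sharp band-curve envelopes, part 1:
# trigonometric preliminaries

Cell `gate-hubbard-kl`, seat fs-1 (g4), risk-register item r2 «Fermi-surface hypotheses on the window», in the service
of r1 «explicit constants». This is the elementary-analysis layer of the SHARP closed-form `BandBounds` bundle
(`KLProgrammeFermiSurfaceSharpEnvelope.lean`, `…SharpCurvature.lean`, `…SharpBandBounds.lean`): one-variable facts
about `sin`, `cos`, `arccos` with no reference to the band.

* `t sin t ≥ 0` on `|t| ≤ π`; `sin t / t` antitone on `(0, π]`; `a ↦ cos √a` convex on `[0, π²]` (re-proved: the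
  copies in `FermiRG/BGM2006Sec2Lemma21Proof.lean` are private); the two-point Jensen and Karamata inequalities
  `2 cos √((x²+y²)/2) ≤ cos x + cos y ≤ 1 + cos √(x²+y²)`.
* **The core inequality** `(x² + y²)(sin² x + sin² y) ≤ 2 (x sin x + y sin y)²` for `|x| + |y| ≤ π`, from the
  identity `2W² - u²S = (x+y) sin(x+y) · (x-y) sin(x-y) + 4 (x sin x)(y sin y)` — on a level curve of the band
  this is `|u'| ≤ u`, i.e. the angle between `∇ε` and the radius vector is at most `π/4`.
* **The tangent-line inequality** `t sin t - s₀ t² ≤ L (cos t - cos d)` (`s₀ = sin d/d`, `L = ψ(d) - 1`,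
  `ψ(t) = t(2s₀ - cos t)/sin t` monotone on `(0, π)`), i.e. concavity of
  `a ↦ arccos a · sin(arccos a) - s₀ arccos² a`; its two-point consequence
  `x sin x + y sin y ≤ (sin d/d)(x² + y²)` when `cos x + cos y = 2 cos d` — on the curve: `c ≤ sin d_μ/d_μ`.
* the arithmetic step of the acceleration envelope (`klfs_accel_aux`).

No definitions; everything PROVED. [folklore]
-/

noncomputable section

open Real Set

-- the tree's namespace `Summit.<Summit>.<Problem>.Theorems` repeats the summit name by design (D-0017)
set_option linter.dupNamespace false

namespace Summit.HubbardSuperconductivity.HubbardSuperconductivity.Theorems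


/-! ### §0 Trigonometric preliminaries -/

/-- `t sin t ≥ 0` for `|t| ≤ π`. [folklore] -/
private theorem klfs_mul_sin_nonneg {t : ℝ} (ht : |t| ≤ π) : 0 ≤ t * Real.sin t := by
  rcases le_or_gt 0 t with h | h
  · exact mul_nonneg h (Real.sin_nonneg_of_nonneg_of_le_pi h (by rwa [abs_of_nonneg h] at ht))
  · have h1 : Real.sin t ≤ 0 := by
      rw [← neg_nonneg, ← Real.sin_neg]
      exact Real.sin_nonneg_of_nonneg_of_le_pi (by linarith) (by rw [abs_of_neg h] at ht; linarith)
    nlinarith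

/-- `sin y / y ≤ sin x / x` for `0 < x ≤ y ≤ π` (concavity of `sin` on `[0, π]`). [folklore]
-- adapted from the private `sin_div_le_sin_div` of `FermiRG/BGM2006Sec2Lemma21Proof.lean` -/
private theorem klfs_sin_div_le_sin_div {x y : ℝ} (hx : 0 < x) (hxy : x ≤ y) (hy : y ≤ π) :
    Real.sin y / y ≤ Real.sin x / x := by
  have hconv : ConvexOn ℝ (Icc 0 π) (fun t => -Real.sin t) := (strictConcaveOn_sin_Icc.concaveOn).neg
  have hy0 : 0 < y := hx.trans_le hxy
  rcases hxy.eq_or_lt with heq | hlt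
  · rw [heq]
  have h := hconv.secant_mono (a := 0) (x := x) (y := y) ⟨le_rfl, Real.pi_pos.le⟩
    ⟨hx.le, hxy.trans hy⟩ ⟨hy0.le, hy⟩ hx.ne' hy0.ne' hxy
  simp only [Real.sin_zero, neg_zero, sub_zero] at h
  rw [neg_div, neg_div] at h
  linarith

/-- The derivative of `a ↦ cos √a` at `a > 0`. [folklore] -/
theorem klfs_hasDerivAt_cos_sqrt {a : ℝ} (ha : 0 < a) :
    HasDerivAt (fun b => Real.cos (Real.sqrt b)) (-Real.sin (Real.sqrt a) * (1 / (2 * Real.sqrt a))) a :=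
  (Real.hasDerivAt_sqrt ha.ne').cos

/-- **`a ↦ cos √a` is convex on `[0, π²]`** (its derivative `-sin √a/(2√a)` is increasing because `sin t/t`
decreases on `(0, π]`). [folklore]
-- adapted from the private `convexOn_cos_sqrt` of `FermiRG/BGM2006Sec2Lemma21Proof.lean` -/
theorem klfs_convexOn_cos_sqrt : ConvexOn ℝ (Icc 0 (π ^ 2)) (fun a => Real.cos (Real.sqrt a)) := by
  have hint : interior (Icc (0 : ℝ) (π ^ 2)) = Ioo 0 (π ^ 2) := interior_Icc
  refine MonotoneOn.convexOn_of_deriv (convex_Icc _ _) ?_ ?_ ?_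
  · exact (Real.continuous_cos.comp Real.continuous_sqrt).continuousOn
  · rw [hint]
    intro a ha
    exact (klfs_hasDerivAt_cos_sqrt ha.1).differentiableAt.differentiableWithinAt
  · rw [hint]
    intro a ha b hb hab
    rw [(klfs_hasDerivAt_cos_sqrt ha.1).deriv, (klfs_hasDerivAt_cos_sqrt hb.1).deriv]
    have hsa : 0 < Real.sqrt a := Real.sqrt_pos.2 ha.1
    have hsb : 0 < Real.sqrt b := Real.sqrt_pos.2 hb.1
    have hab' : Real.sqrt a ≤ Real.sqrt b := Real.sqrt_le_sqrt hab
    have hbπ : Real.sqrt b ≤ π := by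
      rw [← Real.sqrt_sq Real.pi_pos.le]
      exact Real.sqrt_le_sqrt hb.2.le
    have h := klfs_sin_div_le_sin_div hsa hab' hbπ
    rw [div_le_div_iff₀ hsb hsa] at h
    have e1 : -Real.sin (Real.sqrt a) * (1 / (2 * Real.sqrt a)) = -(Real.sin (Real.sqrt a) / Real.sqrt a) / 2 := by
      field_simp
    have e2 : -Real.sin (Real.sqrt b) * (1 / (2 * Real.sqrt b)) = -(Real.sin (Real.sqrt b) / Real.sqrt b) / 2 := by
      field_simp
    rw [e1, e2]
    have h' : Real.sin (Real.sqrt b) / Real.sqrt b ≤ Real.sin (Real.sqrt a) / Real.sqrt a := by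
      rw [div_le_div_iff₀ hsb hsa]; linarith
    linarith

/-- **Two-point Jensen**: `2 cos √((x² + y²)/2) ≤ cos x + cos y` whenever `|x|, |y| ≤ π` (equality iff
`|x| = |y|`: on a circle, `cos x + cos y` is smallest on the diagonals). [folklore] -/
theorem klfs_two_mul_cos_sqrt_le {x y : ℝ} (hx : |x| ≤ π) (hy : |y| ≤ π) :
    2 * Real.cos (Real.sqrt ((x ^ 2 + y ^ 2) / 2)) ≤ Real.cos x + Real.cos y := by
  have hc := klfs_convexOn_cos_sqrt
  have hπ2 : 0 ≤ π := Real.pi_pos.le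
  have hxm : x ^ 2 ∈ Icc 0 (π ^ 2) := ⟨sq_nonneg x, by rw [← sq_abs]; exact pow_le_pow_left₀ (abs_nonneg x) hx 2⟩
  have hym : y ^ 2 ∈ Icc 0 (π ^ 2) := ⟨sq_nonneg y, by rw [← sq_abs]; exact pow_le_pow_left₀ (abs_nonneg y) hy 2⟩
  have h := hc.2 hxm hym (by norm_num : (0 : ℝ) ≤ 1 / 2) (by norm_num : (0 : ℝ) ≤ 1 / 2) (by norm_num)
  simp only [smul_eq_mul] at h
  have e : 1 / 2 * x ^ 2 + 1 / 2 * y ^ 2 = (x ^ 2 + y ^ 2) / 2 := by ring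
  rw [e, Real.sqrt_sq_eq_abs, Real.sqrt_sq_eq_abs, Real.cos_abs, Real.cos_abs] at h
  linarith

/-- **Karamata chord form**: `cos x + cos y ≤ 1 + cos √(x² + y²)` whenever `x² + y² ≤ π²` (on a circle
`cos x + cos y` is largest on the axes). [folklore]
-- adapted from the private `cos_sqrt_add_cos_sqrt_le` of `FermiRG/BGM2006Sec2Lemma21Proof.lean` -/
theorem klfs_cos_add_cos_le_one_add_cos_sqrt {x y : ℝ} (h : x ^ 2 + y ^ 2 ≤ π ^ 2) :
    Real.cos x + Real.cos y ≤ 1 + Real.cos (Real.sqrt (x ^ 2 + y ^ 2)) := by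
  set u := x ^ 2 with hu_def
  set v := y ^ 2 with hv_def
  have hu : 0 ≤ u := sq_nonneg x
  have hv : 0 ≤ v := sq_nonneg y
  have hxu : Real.cos x = Real.cos (Real.sqrt u) := by rw [hu_def, Real.sqrt_sq_eq_abs, Real.cos_abs]
  have hyv : Real.cos y = Real.cos (Real.sqrt v) := by rw [hv_def, Real.sqrt_sq_eq_abs, Real.cos_abs]
  rw [hxu, hyv]
  rcases (add_nonneg hu hv).eq_or_lt with h0 | hpos
  · have hu0 : u = 0 := by linarith
    have hv0 : v = 0 := by linarith
    simp [hu0, hv0]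
  have hc := klfs_convexOn_cos_sqrt
  have h0mem : (0 : ℝ) ∈ Icc 0 (π ^ 2) := ⟨le_rfl, by positivity⟩
  have hsmem : u + v ∈ Icc 0 (π ^ 2) := ⟨hpos.le, h⟩
  have hwu : 0 ≤ u / (u + v) := div_nonneg hu hpos.le
  have hwv : 0 ≤ v / (u + v) := div_nonneg hv hpos.le
  have hsum1 : v / (u + v) + u / (u + v) = 1 := by
    rw [← add_div, div_eq_one_iff_eq hpos.ne']; ring
  have hsum2 : u / (u + v) + v / (u + v) = 1 := by
    rw [← add_div, div_eq_one_iff_eq hpos.ne']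
  have h1 := hc.2 h0mem hsmem hwv hwu hsum1
  have h2 := hc.2 h0mem hsmem hwu hwv hsum2
  simp only [smul_eq_mul, mul_zero, zero_add, Real.sqrt_zero, Real.cos_zero, mul_one] at h1 h2
  have eu : u / (u + v) * (u + v) = u := by field_simp
  have ev : v / (u + v) * (u + v) = v := by field_simp
  rw [eu] at h1
  rw [ev] at h2
  have key : u / (u + v) * Real.cos (Real.sqrt (u + v)) + v / (u + v) * Real.cos (Real.sqrt (u + v)) =
      Real.cos (Real.sqrt (u + v)) := by rw [← add_mul, hsum2, one_mul]
  linarith [h1, h2, key, hsum1]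

/-- **The core inequality**: `(x² + y²)(sin² x + sin² y) ≤ 2 (x sin x + y sin y)²` whenever `|x| + |y| ≤ π`,
i.e. the angle between `(x, y)` and `(sin x, sin y)` is at most `π/4`. Proof:
`2W² - u²S = (x+y) sin(x+y) · (x-y) sin(x-y) + 4 (x sin x)(y sin y)` and each factor `t sin t` is `≥ 0`
for `|t| ≤ π`. [folklore] -/
theorem klfs_sq_mul_sin_sq_le {x y : ℝ} (h : |x| + |y| ≤ π) :
    (x ^ 2 + y ^ 2) * (Real.sin x ^ 2 + Real.sin y ^ 2) ≤ 2 * (x * Real.sin x + y * Real.sin y) ^ 2 := by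
  have hx : |x| ≤ π := by linarith [abs_nonneg y]
  have hy : |y| ≤ π := by linarith [abs_nonneg x]
  have hp : |x + y| ≤ π := (abs_add_le x y).trans h
  have hm : |x - y| ≤ π := (abs_sub x y).trans h
  have h1 := klfs_mul_sin_nonneg hx
  have h2 := klfs_mul_sin_nonneg hy
  have h3 := klfs_mul_sin_nonneg hp
  have h4 := klfs_mul_sin_nonneg hm
  have hid : Real.sin x ^ 2 - Real.sin y ^ 2 = Real.sin (x + y) * Real.sin (x - y) := by
    rw [Real.sin_add, Real.sin_sub]
    have cx := Real.sin_sq_add_cos_sq x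
    have cy := Real.sin_sq_add_cos_sq y
    nlinarith [cx, cy]
  have key : 2 * (x * Real.sin x + y * Real.sin y) ^ 2 - (x ^ 2 + y ^ 2) * (Real.sin x ^ 2 + Real.sin y ^ 2) =
      ((x + y) * Real.sin (x + y)) * ((x - y) * Real.sin (x - y)) + 4 * ((x * Real.sin x) * (y * Real.sin y)) := by
    have : ((x + y) * Real.sin (x + y)) * ((x - y) * Real.sin (x - y)) =
        (x ^ 2 - y ^ 2) * (Real.sin x ^ 2 - Real.sin y ^ 2) := by rw [hid]; ring
    rw [this]; ring
  nlinarith [mul_nonneg h3 h4, mul_nonneg h1 h2, key]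

/-! ### §0' The tangent-line inequality behind `c ≤ sin d / d` -/

/-- `sin t - t cos t ≥ 0` on `[0, π]`. [folklore] -/
theorem klfs_sin_sub_mul_cos_nonneg {t : ℝ} (h0 : 0 ≤ t) (hπ : t ≤ π) : 0 ≤ Real.sin t - t * Real.cos t := by
  have hd : ∀ s, HasDerivAt (fun s => Real.sin s - s * Real.cos s) (s * Real.sin s) s := by
    intro s
    exact ((Real.hasDerivAt_sin s).sub ((hasDerivAt_id' s).mul (Real.hasDerivAt_cos s))).congr_deriv (by ring)
  have hmono : MonotoneOn (fun s => Real.sin s - s * Real.cos s) (Icc 0 π) := by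
    refine monotoneOn_of_deriv_nonneg (convex_Icc 0 π) ?_ ?_ ?_
    · exact fun s _ => (hd s).continuousAt.continuousWithinAt
    · exact fun s _ => (hd s).differentiableAt.differentiableWithinAt
    · intro s hs
      rw [interior_Icc] at hs
      rw [(hd s).deriv]
      exact klfs_mul_sin_nonneg (by rw [abs_of_pos hs.1]; exact hs.2.le)
  have := hmono ⟨le_rfl, Real.pi_pos.le⟩ ⟨h0, hπ⟩ h0
  simpa using this

/-- `t - sin t cos t ≥ 0` for `t ≥ 0` (`sin 2t ≤ 2t`). [folklore] -/
theorem klfs_sub_sin_mul_cos_nonneg {t : ℝ} (h0 : 0 ≤ t) : 0 ≤ t - Real.sin t * Real.cos t := by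
  have h := Real.sin_le (by linarith : 0 ≤ 2 * t)
  rw [Real.sin_two_mul] at h
  linarith

/-- The auxiliary function `ψ(t) = t (2s₀ - cos t)/sin t` is **monotone on `(0, π)`** for every `s₀ ≥ 0`:
`ψ' sin² t = 2s₀ (sin t - t cos t) + (t - sin t cos t) ≥ 0`. [folklore] -/
theorem klfs_psi_monotoneOn {s₀ : ℝ} (hs₀ : 0 ≤ s₀) :
    MonotoneOn (fun t => t * (2 * s₀ - Real.cos t) / Real.sin t) (Ioo 0 π) := by
  have hd : ∀ t ∈ Ioo 0 π, HasDerivAt (fun t => t * (2 * s₀ - Real.cos t) / Real.sin t)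
      (((1 * (2 * s₀ - Real.cos t) + t * Real.sin t) * Real.sin t - t * (2 * s₀ - Real.cos t) * Real.cos t) /
        Real.sin t ^ 2) t := by
    intro t ht
    have hsin : Real.sin t ≠ 0 := (Real.sin_pos_of_pos_of_lt_pi ht.1 ht.2).ne'
    have hnum : HasDerivAt (fun t => t * (2 * s₀ - Real.cos t)) (1 * (2 * s₀ - Real.cos t) + t * Real.sin t) t := by
      exact ((hasDerivAt_id' t).mul ((Real.hasDerivAt_cos t).const_sub (2 * s₀))).congr_deriv (by ring)
    exact hnum.div (Real.hasDerivAt_sin t) hsin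
  refine monotoneOn_of_deriv_nonneg (convex_Ioo 0 π) ?_ ?_ ?_
  · exact fun t ht => (hd t ht).continuousAt.continuousWithinAt
  · rw [interior_Ioo]; exact fun t ht => (hd t ht).differentiableAt.differentiableWithinAt
  · rw [interior_Ioo]
    intro t ht
    rw [(hd t ht).deriv]
    have hsin : 0 < Real.sin t := Real.sin_pos_of_pos_of_lt_pi ht.1 ht.2
    apply div_nonneg _ (sq_nonneg _)
    have h1 := klfs_sin_sub_mul_cos_nonneg ht.1.le ht.2.le
    have h2 := klfs_sub_sin_mul_cos_nonneg ht.1.le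
    have hsc := Real.sin_sq_add_cos_sq t
    have key : (1 * (2 * s₀ - Real.cos t) + t * Real.sin t) * Real.sin t - t * (2 * s₀ - Real.cos t) * Real.cos t =
        2 * s₀ * (Real.sin t - t * Real.cos t) + (t * (Real.sin t ^ 2 + Real.cos t ^ 2) - Real.sin t * Real.cos t) := by
      ring
    rw [key, hsc, mul_one]
    nlinarith

/-- **Tangent-line inequality.** For `0 < d < π`, `s₀ = sin d / d` and `L = d (2 s₀ - cos d)/sin d - 1`, every
`t ∈ [0, π]` satisfies `t sin t - s₀ t² ≤ L (cos t - cos d)` (with equality at `t = d`): the function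
`g(t) = t sin t - s₀ t² - L (cos t - cos d)` has `g' = sin t · (ψ(d) - ψ(t))`, so it increases on `[0, d]` and
decreases on `[d, π]`, and `g(d) = 0`. This is the concavity, in the variable `a = cos t`, of
`a ↦ arccos a · sin(arccos a) - s₀ arccos² a`. [folklore] -/
theorem klfs_tangent_line_ineq {d : ℝ} (hd0 : 0 < d) (hdπ : d < π) {t : ℝ} (ht0 : 0 ≤ t) (htπ : t ≤ π) :
    t * Real.sin t - Real.sin d / d * t ^ 2 ≤
      (d * (2 * (Real.sin d / d) - Real.cos d) / Real.sin d - 1) * (Real.cos t - Real.cos d) := by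
  set s₀ : ℝ := Real.sin d / d with hs₀
  set L : ℝ := d * (2 * s₀ - Real.cos d) / Real.sin d - 1 with hL
  have hsind : 0 < Real.sin d := Real.sin_pos_of_pos_of_lt_pi hd0 hdπ
  have hs₀nn : 0 ≤ s₀ := by rw [hs₀]; exact div_nonneg hsind.le hd0.le
  have hgd : d * Real.sin d - s₀ * d ^ 2 - L * (Real.cos d - Real.cos d) = 0 := by
    rw [hs₀, sub_self, mul_zero, sub_zero]; field_simp; ring
  have hderiv : ∀ t, HasDerivAt (fun t => t * Real.sin t - s₀ * t ^ 2 - L * (Real.cos t - Real.cos d))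
      (Real.sin t + t * Real.cos t - s₀ * (2 * t) + L * Real.sin t) t := by
    intro t
    have h1 : HasDerivAt (fun t => t * Real.sin t) (1 * Real.sin t + t * Real.cos t) t :=
      (hasDerivAt_id' t).mul (Real.hasDerivAt_sin t)
    have h2 : HasDerivAt (fun t => s₀ * t ^ 2) (s₀ * (2 * t)) t := by
      simpa using (hasDerivAt_pow 2 t).const_mul s₀
    have h3 : HasDerivAt (fun t => L * (Real.cos t - Real.cos d)) (L * (-Real.sin t)) t :=
      ((Real.hasDerivAt_cos t).sub_const (Real.cos d)).const_mul L
    exact ((h1.sub h2).sub h3).congr_deriv (by ring)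
  -- on `(0, π)`: `g'(t) = sin t (ψ d - ψ t)`
  have hderiv_eq : ∀ t ∈ Ioo 0 π, Real.sin t + t * Real.cos t - s₀ * (2 * t) + L * Real.sin t =
      Real.sin t * (d * (2 * s₀ - Real.cos d) / Real.sin d - t * (2 * s₀ - Real.cos t) / Real.sin t) := by
    intro t ht
    have hsint : Real.sin t ≠ 0 := (Real.sin_pos_of_pos_of_lt_pi ht.1 ht.2).ne'
    rw [hL]
    field_simp
    ring
  have hψ := klfs_psi_monotoneOn hs₀nn
  have hdmem : d ∈ Ioo 0 π := ⟨hd0, hdπ⟩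
  -- `g` increases on `[0, d]`
  have hmono : MonotoneOn (fun t => t * Real.sin t - s₀ * t ^ 2 - L * (Real.cos t - Real.cos d)) (Icc 0 d) := by
    refine monotoneOn_of_deriv_nonneg (convex_Icc 0 d) ?_ ?_ ?_
    · exact fun t _ => (hderiv t).continuousAt.continuousWithinAt
    · exact fun t _ => (hderiv t).differentiableAt.differentiableWithinAt
    · intro t ht
      rw [interior_Icc] at ht
      have htI : t ∈ Ioo 0 π := ⟨ht.1, ht.2.trans hdπ⟩
      rw [(hderiv t).deriv, hderiv_eq t htI]
      exact mul_nonneg (Real.sin_pos_of_pos_of_lt_pi htI.1 htI.2).le (sub_nonneg.2 (hψ htI hdmem ht.2.le))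
  -- `g` decreases on `[d, π]`
  have hanti : AntitoneOn (fun t => t * Real.sin t - s₀ * t ^ 2 - L * (Real.cos t - Real.cos d)) (Icc d π) := by
    refine antitoneOn_of_deriv_nonpos (convex_Icc d π) ?_ ?_ ?_
    · exact fun t _ => (hderiv t).continuousAt.continuousWithinAt
    · exact fun t _ => (hderiv t).differentiableAt.differentiableWithinAt
    · intro t ht
      rw [interior_Icc] at ht
      have htI : t ∈ Ioo 0 π := ⟨hd0.trans ht.1, ht.2⟩
      rw [(hderiv t).deriv, hderiv_eq t htI]
      exact mul_nonpos_of_nonneg_of_nonpos (Real.sin_pos_of_pos_of_lt_pi htI.1 htI.2).le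
        (sub_nonpos.2 (hψ hdmem htI ht.1.le))
  have hgt : t * Real.sin t - s₀ * t ^ 2 - L * (Real.cos t - Real.cos d) ≤ 0 := by
    rcases le_total t d with htd | hdt
    · rw [← hgd]; exact hmono ⟨ht0, htd⟩ ⟨hd0.le, le_rfl⟩ htd
    · rw [← hgd]; exact hanti ⟨le_rfl, hdπ.le⟩ ⟨hdt, htπ⟩ hdt
  rw [hs₀] at hgt ⊢
  rw [hL, hs₀] at hgt
  linarith

/-- **Two-point consequence**: if `cos x + cos y = 2 cos d` with `0 < d < π` and `|x|, |y| ≤ π`, then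
`x sin x + y sin y ≤ (sin d / d)(x² + y²)` — the `x²`-weighted mean of `sin t / t` over `{x, y}` is at most its
value at the «cos-mean» `d`. [folklore] -/
theorem klfs_mul_sin_add_le_sinc_mul {x y d : ℝ} (hd0 : 0 < d) (hdπ : d < π) (hx : |x| ≤ π) (hy : |y| ≤ π)
    (h : Real.cos x + Real.cos y = 2 * Real.cos d) :
    x * Real.sin x + y * Real.sin y ≤ Real.sin d / d * (x ^ 2 + y ^ 2) := by
  have h1 := klfs_tangent_line_ineq hd0 hdπ (abs_nonneg x) hx
  have h2 := klfs_tangent_line_ineq hd0 hdπ (abs_nonneg y) hy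
  have ex : |x| * Real.sin |x| = x * Real.sin x := by
    rcases le_or_gt 0 x with h0 | h0
    · rw [abs_of_nonneg h0]
    · rw [abs_of_neg h0, Real.sin_neg]; ring
  have ey : |y| * Real.sin |y| = y * Real.sin y := by
    rcases le_or_gt 0 y with h0 | h0
    · rw [abs_of_nonneg h0]
    · rw [abs_of_neg h0, Real.sin_neg]; ring
  rw [ex, sq_abs, Real.cos_abs] at h1
  rw [ey, sq_abs, Real.cos_abs] at h2
  have hsum : Real.cos x - Real.cos d + (Real.cos y - Real.cos d) = 0 := by linarith
  have := add_le_add h1 h2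
  rw [← mul_add, hsum, mul_zero] at this
  linarith

/-- The arithmetic of the acceleration envelope: from `W |A| ≤ u K² + 2 u² ρ`, `u ρ ≤ √2 W`, `s ≤ ρ`, `u ≤ K`
conclude `|A| ≤ √2 (K²/s + 2K)`. [folklore] -/
theorem klfs_accel_aux {A W u K ρ s : ℝ} (hu : 0 < u) (hρ : 0 < ρ) (hs : 0 < s) (hsρ : s ≤ ρ) (huK : u ≤ K)
    (hW : u * ρ ≤ Real.sqrt 2 * W) (hb : W * |A| ≤ u * K ^ 2 + 2 * u ^ 2 * ρ) :
    |A| ≤ Real.sqrt 2 * (K ^ 2 / s + 2 * K) := by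
  have h2 : 0 < Real.sqrt 2 := Real.sqrt_pos.2 (by norm_num)
  have step : |A| * (u * ρ) ≤ Real.sqrt 2 * (u * K ^ 2 + 2 * u ^ 2 * ρ) := by
    calc |A| * (u * ρ) ≤ |A| * (Real.sqrt 2 * W) := mul_le_mul_of_nonneg_left hW (abs_nonneg _)
      _ = Real.sqrt 2 * (W * |A|) := by ring
      _ ≤ _ := mul_le_mul_of_nonneg_left hb h2.le
  have hden : 0 < u * ρ := mul_pos hu hρ
  have h1 : |A| ≤ Real.sqrt 2 * (K ^ 2 / ρ + 2 * u) := by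
    rw [← le_div_iff₀ hden] at step
    refine step.trans (le_of_eq ?_)
    field_simp
  have hK2 : K ^ 2 / ρ ≤ K ^ 2 / s := div_le_div_of_nonneg_left (sq_nonneg K) hs hsρ
  nlinarith [h1, hK2, h2]

end Summit.HubbardSuperconductivity.HubbardSuperconductivity.Theorems

end
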